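import Summits.ResolutionOfSingularities.ResolutionOfSingularities.Theorems.DescentDescentPerfectToAllResidualWitnessMacLane
import Summits.ResolutionOfSingularities.ResolutionOfSingularities.Theorems.DescentDescentPerfectToAllPIndependence
import Mathlib.Logic.Equiv.Fin.Basic
import HarnessLib

/-!
# `DescentPerfectToAll` (stmt-ResolutionOfSingularities-0549): Mac Lane's field `S₁` has INFINITE `p`-rank
# (part 3: the `y_n` are `p`-independent)

Route `ResolutionOfSingularities/Descent`, crux `DescentPerfectToAll`. Helper (OURS; not a statement of any
manuscript; `--supports` the crux, does not close it). Sequel of `DescentDescentPerfectToAllResidualWitnessMacLane`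
(tower `𝓛 = 𝔽_p(T, Y) ⊆ A = Frac(𝔽_p[s₀, s₁, …])`, `t_n = s_n^p`, `y_n = s_n + s_{n+1} s_{n+2}^p`, derivations and the
fraction trick) and companion of `…MacLaneExhaustion` (`𝓛` is not EFT-separably exhausted). Answers RUNG-B-LIT
§11b (γ) (res-lit-3, 2026-08-27): the new residual inhabitant is NOT of `p`-rank-defect type.

* `coordDerivation_macLaneY_of_lt`, `coordDerivation_macLaneY_self` — the coordinate derivation `∂/∂s_{M+1}` kills
  `y_k` for `k < M` and sends `y_M ↦ s_{M+2}^p`;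
* `macLaneY_not_divConst` — `y_M` is not a quotient of two `∂/∂s_{M+1}`-constants;
* `macLaneY_not_mem_closure_frobenius` — CHAIN CONDITION in `A`: `y_j ∉ A^p(y_0, …, y_{j−1})` (every element of
  that subfield is a quotient of `∂/∂s_{j+1}`-constants);
* `macLaneY_pIndependent` — hence (tree `pIndependent_of_chain`) the `p^m` reduced monomials in `y_0, …, y_{m−1}`
  are `A^p`-linearly independent: `Σ_α y^α e_α^p = 0 ⇒ e = 0`;
* `linearIndependent_frobenius_macLane_monomials` — for ANY subfield `L ≤ A` containing the `y_i`, these monomials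
  are linearly independent over `L^p = (frobenius L p).fieldRange` (fewer scalars);
* `not_frobenius_rank_le_of_macLaneY_mem`, `macLaneField_frobenius_rank_unbounded` — so hypothesis (a) of the
  `p`-rank-defect criterion `not_exhaustedByEssFiniteType_of_pRank_le` («every `L^p`-free finite family has
  `≤ p^r` members») FAILS for `𝓛` for every `r`: `[𝓛 : 𝓛^p] = ∞`. Together with part 2, `𝓛` is a residual
  inhabitant of infinite `p`-rank; by the dichotomy `exhaustedByEssFiniteType_iff_exists_pIndependent_of_perfectCore`
  (finite transcendence degree `n` over the perfect core ⇒ a non-exhausted field has `p`-rank `< n`) it has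
  infinite transcendence degree over its perfect core (reading; not re-derived here).

[cite: MacLane1939SteinitzTowers, §8 Lemma 8.1, Lemma 8.4] [cite: MacLane1939ModularFieldsI, §7 Example (1), fn. 21]
[cite: Matsumura1987, Thm. 26.5]
-/

noncomputable section

set_option linter.dupNamespace false -- mandated namespace of this single-conjunct summit

open MvPolynomial

namespace Summit.ResolutionOfSingularities.ResolutionOfSingularities.Theorems

variable (p : ℕ) [Fact p.Prime]

/-! ## 1 The coordinate derivation `∂/∂s_{M+1}` on the tower -/

/-- `∂y_k/∂s_{M+1} = 0` for `k < M`. [folklore] -/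
theorem coordDerivation_macLaneY_of_lt (M k : ℕ) (hk : k < M) :
    mkDerivation (ZMod p) (fun j => if j = M + 1 then (1 : MvPolynomial ℕ (ZMod p)) else 0)
      (X k + X (k + 1) * X (k + 2) ^ p) = 0 := by
  rw [mkDerivation_macLaneY, if_neg (show k ≠ M + 1 by omega), if_neg (show k + 1 ≠ M + 1 by omega), mul_zero,
    add_zero]

/-- `∂y_M/∂s_{M+1} = s_{M+2}^p`. [folklore] -/
theorem coordDerivation_macLaneY_self (M : ℕ) :
    mkDerivation (ZMod p) (fun j => if j = M + 1 then (1 : MvPolynomial ℕ (ZMod p)) else 0)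
      (X M + X (M + 1) * X (M + 2) ^ p) = X (M + 2) ^ p := by
  rw [mkDerivation_macLaneY, if_neg (show M ≠ M + 1 by omega), if_pos rfl, mul_one, zero_add]

/-- `y_M` is NOT a quotient `a/b` of `∂/∂s_{M+1}`-constants `a, b ∈ 𝔽_p[s]`: `y_M·b = a` gives `s_{M+2}^p·b = 0`.
[folklore] -/
theorem macLaneY_not_divConst (M : ℕ) :
    ¬ ∃ a b : MvPolynomial ℕ (ZMod p),
      (mkDerivation (ZMod p) (fun j => if j = M + 1 then (1 : MvPolynomial ℕ (ZMod p)) else 0)).restrictScalars ℤ a = 0 ∧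
      (mkDerivation (ZMod p) (fun j => if j = M + 1 then (1 : MvPolynomial ℕ (ZMod p)) else 0)).restrictScalars ℤ b = 0 ∧
      algebraMap (MvPolynomial ℕ (ZMod p)) (FractionRing (MvPolynomial ℕ (ZMod p))) a / algebraMap (MvPolynomial ℕ (ZMod p)) (FractionRing (MvPolynomial ℕ (ZMod p))) b = algebraMap (MvPolynomial ℕ (ZMod p)) (FractionRing (MvPolynomial ℕ (ZMod p))) (X M + X (M + 1) * X (M + 2) ^ p) := by
  have f_inj : Function.Injective (algebraMap (MvPolynomial ℕ (ZMod p)) (FractionRing (MvPolynomial ℕ (ZMod p)))) := IsFractionRing.injective _ _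
  rintro ⟨a, b, ha, hb, hab⟩
  have ha' : mkDerivation (ZMod p) (fun j => if j = M + 1 then (1 : MvPolynomial ℕ (ZMod p)) else 0) a = 0 := ha
  have hb' : mkDerivation (ZMod p) (fun j => if j = M + 1 then (1 : MvPolynomial ℕ (ZMod p)) else 0) b = 0 := hb
  by_cases hb0 : b = 0
  · rw [hb0, map_zero, div_zero] at hab
    have hzero : (X M + X (M + 1) * X (M + 2) ^ p : MvPolynomial ℕ (ZMod p)) = 0 :=
      f_inj (by rw [map_zero]; exact hab.symm)
    have := congrArg (mkDerivation (ZMod p) (fun j => if j = M + 1 then (1 : MvPolynomial ℕ (ZMod p)) else 0)) hzero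
    rw [coordDerivation_macLaneY_self, map_zero] at this
    exact pow_ne_zero _ (X_ne_zero (M + 2)) this
  · have hfb : algebraMap (MvPolynomial ℕ (ZMod p)) (FractionRing (MvPolynomial ℕ (ZMod p))) b ≠ 0 := fun h => hb0 (f_inj (by rw [h, map_zero]))
    have hXb : (X M + X (M + 1) * X (M + 2) ^ p) * b = a :=
      f_inj (by rw [map_mul, ← hab, div_mul_cancel₀ _ hfb])
    have := congrArg (mkDerivation (ZMod p) (fun j => if j = M + 1 then (1 : MvPolynomial ℕ (ZMod p)) else 0)) hXb
    rw [Derivation.leibniz, hb', smul_zero, zero_add, ha', coordDerivation_macLaneY_self, smul_eq_mul] at this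
    exact hb0 ((mul_eq_zero.mp this).resolve_right (pow_ne_zero _ (X_ne_zero (M + 2))))

/-! ## 2 `p`-independence of the `y_n` -/

/-- **Chain condition.** `y_j ∉ A^p(y_0, …, y_{j−1})` in `A = Frac(𝔽_p[s])`: every element of the subfield generated
by the `p`-th powers of `A` and `y_0, …, y_{j−1}` is a quotient of two `∂/∂s_{j+1}`-constants, `y_j` is not.
[cite: MacLane1939SteinitzTowers, §8 Lemma 8.1] -/
theorem macLaneY_not_mem_closure_frobenius (m : ℕ) (j : Fin m) :
    algebraMap (MvPolynomial ℕ (ZMod p)) (FractionRing (MvPolynomial ℕ (ZMod p))) (X (j : ℕ) + X ((j : ℕ) + 1) * X ((j : ℕ) + 2) ^ p) ∉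
      Subfield.closure (Set.range (fun x : FractionRing (MvPolynomial ℕ (ZMod p)) => x ^ p) ∪
        (fun i : Fin m => algebraMap (MvPolynomial ℕ (ZMod p)) (FractionRing (MvPolynomial ℕ (ZMod p))) (X (i : ℕ) + X ((i : ℕ) + 1) * X ((i : ℕ) + 2) ^ p)) '' {i : Fin m | i < j}) := by
  classical
  intro hmem
  set D := (mkDerivation (ZMod p) (fun i => if i = (j : ℕ) + 1 then (1 : MvPolynomial ℕ (ZMod p)) else 0)).restrictScalars ℤ
    with hD
  let P : FractionRing (MvPolynomial ℕ (ZMod p)) → Prop := fun x =>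
    ∃ a b : MvPolynomial ℕ (ZMod p), D a = 0 ∧ D b = 0 ∧ algebraMap (MvPolynomial ℕ (ZMod p)) (FractionRing (MvPolynomial ℕ (ZMod p))) a / algebraMap (MvPolynomial ℕ (ZMod p)) (FractionRing (MvPolynomial ℕ (ZMod p))) b = x
  obtain ⟨⟨hP0, hP1⟩, hPadd, hPmul, hPneg, hPinv, hPpow⟩ := divConst_closure D P (fun x => Iff.rfl)
  have key : ∀ x ∈ Subfield.closure (Set.range (fun x : FractionRing (MvPolynomial ℕ (ZMod p)) => x ^ p) ∪
      (fun i : Fin m => algebraMap (MvPolynomial ℕ (ZMod p)) (FractionRing (MvPolynomial ℕ (ZMod p))) (X (i : ℕ) + X ((i : ℕ) + 1) * X ((i : ℕ) + 2) ^ p)) '' {i : Fin m | i < j}), P x := by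
    intro x hx
    induction hx using Subfield.closure_induction with
    | mem x hx =>
      rcases hx with ⟨z, rfl⟩ | ⟨i, hi, rfl⟩
      · exact hPpow p z (fun q => derivation_int_pow_char_eq_zero p D q)
      · refine ⟨X (i : ℕ) + X ((i : ℕ) + 1) * X ((i : ℕ) + 2) ^ p, 1, ?_, D.map_one_eq_zero, by rw [map_one, div_one]⟩
        have hi' : (i : ℕ) < (j : ℕ) := hi
        exact coordDerivation_macLaneY_of_lt p (j : ℕ) (i : ℕ) hi'
    | one => exact hP1
    | add x y _ _ hx hy => exact hPadd _ _ hx hy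
    | neg x _ hx => exact hPneg _ hx
    | inv x _ hx => exact hPinv _ hx
    | mul x y _ _ hx hy => exact hPmul _ _ hx hy
  have hPx := key _ hmem
  exact macLaneY_not_divConst p (j : ℕ) hPx

/-- **The reduced monomials in `y_0, …, y_{m−1}` are `A^p`-linearly independent**: `Σ_α (∏ y_i^{α_i}) e_α^p = 0`
with `0 ≤ α_i < p` forces `e = 0` (tree `pIndependent_of_chain` on the chain condition).
[cite: MacLane1939SteinitzTowers, §8 Lemma 8.1] [cite: Matsumura1987, Thm. 26.5] -/
theorem macLaneY_pIndependent (m : ℕ) (e : (Fin m → Fin p) → FractionRing (MvPolynomial ℕ (ZMod p)))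
    (he : ∑ α, (∏ i : Fin m, algebraMap (MvPolynomial ℕ (ZMod p)) (FractionRing (MvPolynomial ℕ (ZMod p))) (X (i : ℕ) + X ((i : ℕ) + 1) * X ((i : ℕ) + 2) ^ p) ^ (α i : ℕ)) * e α ^ p = 0) :
    ∀ α, e α = 0 := by
  haveI : CharP (FractionRing (MvPolynomial ℕ (ZMod p))) p :=
    charP_of_injective_algebraMap (IsFractionRing.injective (MvPolynomial ℕ (ZMod p)) _) p
  exact pIndependent_of_chain (p := p)
    (fun i : Fin m => algebraMap (MvPolynomial ℕ (ZMod p)) (FractionRing (MvPolynomial ℕ (ZMod p))) (X (i : ℕ) + X ((i : ℕ) + 1) * X ((i : ℕ) + 2) ^ p))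
    (macLaneY_not_mem_closure_frobenius p m) e he

/-- **Linear independence over `L^p`.** For ANY subfield `L ≤ A` and elements `y_0, …, y_{m−1} ∈ L` equal to Mac
Lane's `y_i`, the `p^m` reduced monomials `∏ y_i^{α_i}` are linearly independent over
`L^p = (frobenius L p).fieldRange` (a dependence with coefficients `w_α^p` is, in `A`, a relation killed by
`macLaneY_pIndependent`). [cite: MacLane1939SteinitzTowers, §8 Lemma 8.1] -/
theorem linearIndependent_frobenius_macLane_monomials (L : Subfield (FractionRing (MvPolynomial ℕ (ZMod p)))) (m : ℕ) (y : Fin m → L)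
    (hy : ∀ i, ((y i : L) : FractionRing (MvPolynomial ℕ (ZMod p))) = algebraMap (MvPolynomial ℕ (ZMod p)) (FractionRing (MvPolynomial ℕ (ZMod p))) (X (i : ℕ) + X ((i : ℕ) + 1) * X ((i : ℕ) + 2) ^ p)) :
    LinearIndependent (frobenius L p).fieldRange (fun α : Fin m → Fin p => ∏ i, y i ^ (α i : ℕ)) := by
  classical
  have hp : p.Prime := Fact.out
  haveI : CharP (FractionRing (MvPolynomial ℕ (ZMod p))) p :=
    charP_of_injective_algebraMap (IsFractionRing.injective (MvPolynomial ℕ (ZMod p)) _) p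
  haveI : CharP L p := L.subtype.charP Subtype.val_injective p
  rw [Fintype.linearIndependent_iff]
  intro g hg α
  have hw : ∀ β, ∃ w : L, w ^ p = (g β : L) := fun β => by
    obtain ⟨w, hw⟩ := RingHom.mem_fieldRange.1 (g β).2
    exact ⟨w, hw⟩
  choose w hw using hw
  -- push the relation to `A`
  have hrel : ∑ β, (∏ i : Fin m, algebraMap (MvPolynomial ℕ (ZMod p)) (FractionRing (MvPolynomial ℕ (ZMod p))) (X (i : ℕ) + X ((i : ℕ) + 1) * X ((i : ℕ) + 2) ^ p) ^ (β i : ℕ)) *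
      ((w β : L) : FractionRing (MvPolynomial ℕ (ZMod p))) ^ p = 0 := by
    have h0 := congrArg (Subfield.subtype L) hg
    rw [map_sum, map_zero] at h0
    refine Eq.trans (Finset.sum_congr rfl fun β _ => ?_) h0
    rw [Subfield.smul_def, smul_eq_mul, map_mul, map_prod, ← hw β, map_pow, mul_comm]
    congr 1
    refine Finset.prod_congr rfl fun i _ => ?_
    rw [map_pow, Subfield.coe_subtype, hy i]
  have hwα : ((w α : L) : FractionRing (MvPolynomial ℕ (ZMod p))) = 0 := macLaneY_pIndependent p m (fun β => ((w β : L) : FractionRing (MvPolynomial ℕ (ZMod p)))) hrel α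
  have hwα' : w α = 0 := Subtype.ext hwα
  apply Subtype.ext
  rw [← hw α, hwα', zero_pow hp.ne_zero]
  rfl

/-! ## 3 The `p`-rank of Mac Lane's field is infinite -/

/-- **No bound `p^r` on `L^p`-free families.** If a subfield `L ≤ A` contains Mac Lane's `y_0, y_1, …`, then for every
`r` there is an `L^p`-linearly independent family in `L` with more than `p^r` members (the `p^{r+1}` reduced
monomials in `y_0, …, y_r`): hypothesis (a) of `not_exhaustedByEssFiniteType_of_pRank_le` fails for `L` at every `r`.
[cite: MacLane1939SteinitzTowers, §8 Lemma 8.1] [cite: Matsumura1987, Thm. 26.5] -/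
theorem not_frobenius_rank_le_of_macLaneY_mem (L : Subfield (FractionRing (MvPolynomial ℕ (ZMod p)))) (y : ℕ → L)
    (hy : ∀ i : ℕ, ((y i : L) : FractionRing (MvPolynomial ℕ (ZMod p))) = algebraMap (MvPolynomial ℕ (ZMod p)) (FractionRing (MvPolynomial ℕ (ZMod p))) (X i + X (i + 1) * X (i + 2) ^ p)) (r : ℕ) :
    ¬ ∀ (n : ℕ) (v : Fin n → L), LinearIndependent (frobenius L p).fieldRange v → n ≤ p ^ r := by
  classical
  intro h
  have hp : p.Prime := Fact.out
  have hind := linearIndependent_frobenius_macLane_monomials p L (r + 1) (fun i => y i) (fun i => hy i)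
  have hcard : Fintype.card (Fin (r + 1) → Fin p) = p ^ (r + 1) := by simp
  let e : Fin (p ^ (r + 1)) ≃ (Fin (r + 1) → Fin p) := (Fintype.equivFinOfCardEq hcard).symm
  have h' := h (p ^ (r + 1)) ((fun α : Fin (r + 1) → Fin p => ∏ i : Fin (r + 1), y i ^ (α i : ℕ)) ∘ e)
    (hind.comp e e.injective)
  have hlt : p ^ r < p ^ (r + 1) := Nat.pow_lt_pow_right hp.one_lt (Nat.lt_succ_self r)
  exact absurd h' (not_le.mpr hlt)

/-- **Mac Lane's field `𝓛 = 𝔽_p(T, Y)` has infinite `p`-rank**: for every `r`, `𝓛` carries an `𝓛^p`-linearly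
independent family with more than `p^r` members. So `𝓛` is a residual inhabitant (part 2) to which the
`p`-rank-defect criterion `not_exhaustedByEssFiniteType_of_pRank_le` does not apply for any `r` — a new make of
witness. [cite: MacLane1939SteinitzTowers, §8 Lemma 8.1] [cite: MacLane1939ModularFieldsI, §7 Example (1), fn. 21] -/
theorem macLaneField_frobenius_rank_unbounded (L : Subfield (FractionRing (MvPolynomial ℕ (ZMod p))))
    (hL : L = Subfield.closure (algebraMap (MvPolynomial ℕ (ZMod p)) (FractionRing (MvPolynomial ℕ (ZMod p))) '' ({q | ∃ j : ℕ, q = X j ^ p} ∪ {q | ∃ k : ℕ, q = X k + X (k + 1) * X (k + 2) ^ p}))) (r : ℕ) :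
    ¬ ∀ (n : ℕ) (v : Fin n → L), LinearIndependent (frobenius L p).fieldRange v → n ≤ p ^ r := by
  have hyL : ∀ k : ℕ, algebraMap (MvPolynomial ℕ (ZMod p)) (FractionRing (MvPolynomial ℕ (ZMod p))) (X k + X (k + 1) * X (k + 2) ^ p) ∈ L := fun k => by
    rw [hL]; exact Subfield.subset_closure ⟨_, Or.inr ⟨k, rfl⟩, rfl⟩
  exact not_frobenius_rank_le_of_macLaneY_mem p L
    (fun k => ⟨algebraMap (MvPolynomial ℕ (ZMod p)) (FractionRing (MvPolynomial ℕ (ZMod p))) (X k + X (k + 1) * X (k + 2) ^ p), hyL k⟩) (fun _ => rfl) r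

end Summit.ResolutionOfSingularities.ResolutionOfSingularities.Theorems

end
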